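import Literature.Analysis.Complex.RootsOfUnityComplementUniformization
import Literature.Analysis.Complex.AlgebraicFunctionContinuation
import Mathlib.Analysis.Calculus.InverseFunctionTheorem.Analytic
import HarnessLib

/-!
# CDT Proposition 3.0.1, algebraization step: continuation over the universal covering of `ℂ ∖ μ_N`

`Literature/Analysis/Complex/RootsOfUnityComplementRootContinuation.lean` — PROOF-ONLY (no definition,
no named fact). F. Calegari, V. Dimitrov, Y. Tang, *The unbounded denominators conjecture*, J. Amer.
Math. Soc. 38 (2025), proof of Proposition 3.0.1 and Remark 3.0.2 (arXiv:2109.09040, Proposition 15 and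
Remark 16): a modular function `f` of the space `R_{2N}` pulls back along `φ = 16^{-1/N} F_N(r·)` to a
function HOLOMORPHIC ON THE CLOSED UNIT DISC ("Thus `f ∘ φ` is also given by the natural pullback of `f`
from `Y′` to `D(0,1)` and thus it is holomorphic over `D(0,1)` as far as `f` is holomorphic at all cusps
in `Y′`"). This is hypothesis (iii)-analytic of their Theorem 2.0.1 for the families fed into it.

This file proves the CONTINUATION STEP in hypothesis form, with the modular-curve input abstracted into
"root data" on `ℂ ∖ μ_N` (brick B5 of the crux memo `Lines/cdt_thm1-core-map-g39.md` of K★ 22226):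

★ `exists_holomorphic_extension_of_local_root_systems` — let `Φ : 𝔻 → {z | zᴺ ≠ 1}` be a holomorphic
covering with `Φ(0) = 0`, `F : 𝔻 → {z | zᴺ ≠ 1}` holomorphic with `F(0) = 0`, `F′(0) ≠ 0` (the competitor
`16^{1/N}(λ(tᴺ)/16)^{1/N}`), and let `roots : ℂ → Multiset ℂ` (in the application: the values
`{f(γ_i τ)}` over the fibre `x̂(τ) = w` of the uniformizer `x̂ = (λ/16)^{1/N}`, `γ_i` coset representatives)
admit LOCAL HOLOMORPHIC ROOT SYSTEMS at every point of `{w | wᴺ ≠ 1}` (including `w = 0`: the cusp,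
where the cusp-width condition of `R_{2N}` is what makes the branches single-valued), with bounded
cardinality. If `H` is holomorphic near `t = 0` with `H(t) ∈ roots(F t)` (the `t = q^{1/N}`-expansion of
`f`), then, with `ω` the lift of `F` through `Φ` (`Φ ∘ ω = F`, `ω(0) = 0`), there is `y` HOLOMORPHIC ON THE
WHOLE DISC with `y(z) ∈ roots(Φ z)` and `y ∘ ω = H` near `0`.
Proof: the lift `ω` (tree), its local inverse at `0` (`ω′(0) ≠ 0`), the germ `y₀ = H ∘ ω⁻¹`, and the
tree's continuation theorem for unramified algebraic functions over a disc
(`RootContinuation.exists_holomorphic_root_extend`, applied to `∏_{m ∈ roots(Φ z)} (w − m)`, whose local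
root systems on `𝔻` are the pull-backs along `Φ` of those on `{w | wᴺ ≠ 1}`).

## References
* [CalegariDimitrovTang2025] F. Calegari, V. Dimitrov, Y. Tang, J. Amer. Math. Soc. 38 (2025),
  Proposition 3.0.1 (proof) and Remark 3.0.2.
-/

noncomputable section

open Set Metric Filter Polynomial
open scoped Topology

namespace Literature.Analysis.Complex

open _root_.Complex

/-- The polynomial `∏_{m ∈ s} (X − m)` vanishes at `w` iff `w ∈ s`; written as the finite sum
`Σ_{n ≤ d} coeff_n · wⁿ` for any `d ≥ card s`. [folklore] -/
private theorem sum_coeff_prod_X_sub_C_mul_pow_eq_zero_iff (s : Multiset ℂ) {d : ℕ}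
    (hd : Multiset.card s ≤ d) (w : ℂ) :
    ∑ n ∈ Finset.range (d + 1), ((s.map fun m ↦ X - C m).prod).coeff n * w ^ n = 0 ↔ w ∈ s := by
  have hdeg : ((s.map fun m ↦ X - C m).prod).natDegree < d + 1 := by
    rw [natDegree_multiset_prod_X_sub_C_eq_card]; omega
  rw [← eval_eq_sum_range' hdeg, eval_multiset_prod, Multiset.map_map, Multiset.prod_eq_zero_iff,
    Multiset.mem_map]
  simp only [Function.comp_apply, eval_sub, eval_X, eval_C, sub_eq_zero]
  constructor
  · rintro ⟨m, hm, rfl⟩; exact hm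
  · intro h; exact ⟨w, h, rfl⟩

/-- ★ **Continuation over the universal covering of `ℂ ∖ μ_N` (CDT Prop. 3.0.1 / Remark 3.0.2,
hypothesis form).** Let `Φ` be a holomorphic covering of `{z | zᴺ ≠ 1}` by the unit disc with
`Φ(0) = 0`; `F` holomorphic on the disc with values in `{z | zᴺ ≠ 1}`, `F(0) = 0`, `F′(0) ≠ 0`;
`roots : ℂ → Multiset ℂ` with `card (roots w) ≤ d` and LOCAL HOLOMORPHIC ROOT SYSTEMS at every
`w₀` with `w₀ᴺ ≠ 1` (finitely many holomorphic `Y_i` near `w₀` with `Y_i(w) ∈ roots w` and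
`roots w ⊆ {Y_i(w)}`); `H` holomorphic on `|t| < ρ` with `H(t) ∈ roots(F t)`. Then with the lift `ω` of
`F` through `Φ` (`Φ ∘ ω = F`, `ω(0) = 0`) there is `y` holomorphic on the unit disc with
`y(z) ∈ roots(Φ z)` for all `|z| < 1` and `y(ω t) = H(t)` for `t` near `0`.
[cite: CalegariDimitrovTang2025, Proposition 3.0.1 (proof) and Remark 3.0.2] -/
theorem exists_holomorphic_extension_of_local_root_systems {N : ℕ} {Φ : ℂ → ℂ}
    (hΦ : DifferentiableOn ℂ Φ (ball (0 : ℂ) 1)) (hΦU : MapsTo Φ (ball (0 : ℂ) 1) {z : ℂ | z ^ N ≠ 1})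
    (hcov : IsCoveringMap hΦU.restrict) (hΦ0 : Φ 0 = 0)
    {F : ℂ → ℂ} (hFd : DifferentiableOn ℂ F (ball (0 : ℂ) 1)) (hF0 : F 0 = 0) (hF'0 : deriv F 0 ≠ 0)
    (hFU : MapsTo F (ball (0 : ℂ) 1) {z : ℂ | z ^ N ≠ 1})
    (roots : ℂ → Multiset ℂ) {d : ℕ} (hcard : ∀ w, Multiset.card (roots w) ≤ d)
    (hloc : ∀ w₀ : ℂ, w₀ ^ N ≠ 1 → ∃ ε > 0, ∃ (m : ℕ) (Y : Fin m → ℂ → ℂ),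
      (∀ i, DifferentiableOn ℂ (Y i) (ball w₀ ε)) ∧
      (∀ i, ∀ w ∈ ball w₀ ε, w ^ N ≠ 1 → Y i w ∈ roots w) ∧
      (∀ w ∈ ball w₀ ε, w ^ N ≠ 1 → ∀ y ∈ roots w, ∃ i, y = Y i w))
    {H : ℂ → ℂ} {ρ : ℝ} (hρ : 0 < ρ) (hHd : DifferentiableOn ℂ H (ball (0 : ℂ) ρ))
    (hH : ∀ t ∈ ball (0 : ℂ) ρ, ‖t‖ < 1 → H t ∈ roots (F t)) :
    ∃ ω y : ℂ → ℂ, DifferentiableOn ℂ ω (ball (0 : ℂ) 1) ∧ MapsTo ω (ball (0 : ℂ) 1) (ball (0 : ℂ) 1) ∧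
      ω 0 = 0 ∧ (∀ t ∈ ball (0 : ℂ) 1, Φ (ω t) = F t) ∧
      DifferentiableOn ℂ y (ball (0 : ℂ) 1) ∧ (∀ z ∈ ball (0 : ℂ) 1, y z ∈ roots (Φ z)) ∧
      ∀ᶠ t in 𝓝 0, y (ω t) = H t := by
  have hb0 : (0 : ℂ) ∈ ball (0 : ℂ) 1 := mem_ball_self one_pos
  have hb : ball (0 : ℂ) 1 ∈ 𝓝 (0 : ℂ) := ball_mem_nhds _ one_pos
  -- the lift `ω` and its local inverse `ψ` at `0`
  obtain ⟨ω, hωd, hωm, hω0, hΦω⟩ :=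
    Complex.exists_discLift_of_isCoveringMap hΦ hΦU hcov hFd hFU hb0 (by rw [hΦ0, hF0])
  have hωan : AnalyticAt ℂ ω 0 := hωd.analyticAt hb
  have hω'0 : deriv ω 0 ≠ 0 := by
    intro h0
    have hev : F =ᶠ[𝓝 0] fun z ↦ Φ (ω z) := by
      filter_upwards [hb] with z hz using (hΦω z hz).symm
    have h1 : DifferentiableAt ℂ ω 0 := hωd.differentiableAt hb
    have h2 : DifferentiableAt ℂ Φ (ω 0) := hΦ.differentiableAt (by rw [hω0]; exact hb)
    have := hev.deriv_eq
    rw [show (fun z ↦ Φ (ω z)) = Φ ∘ ω from rfl, deriv_comp 0 h2 h1, h0, mul_zero] at this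
    exact hF'0 this
  set ψ : ℂ → ℂ := hωan.hasStrictDerivAt.localInverse ω (deriv ω 0) 0 hω'0 with hψ
  have hψan : AnalyticAt ℂ ψ 0 := by
    have h := hωan.analyticAt_localInverse hω'0
    rwa [hω0] at h
  have hleft : ∀ᶠ t in 𝓝 0, ψ (ω t) = t := hωan.hasStrictDerivAt.eventually_left_inverse hω'0
  have hright : ∀ᶠ z in 𝓝 0, ω (ψ z) = z := by
    have h := hωan.hasStrictDerivAt.eventually_right_inverse hω'0
    rwa [hω0] at h
  have hψ0 : ψ 0 = 0 := by
    have h := HasStrictFDerivAt.localInverse_apply_image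
      (hωan.hasStrictDerivAt.hasStrictFDerivAt_equiv hω'0)
    rw [hω0] at h
    exact h
  -- the germ `y₀ = H ∘ ψ` on a small disc `|z| < r₀`
  have hψcont : ContinuousAt ψ 0 := hψan.continuousAt
  have hψt : Tendsto ψ (𝓝 0) (𝓝 0) := by simpa [ContinuousAt, hψ0] using hψcont
  obtain ⟨U, hUn, hUψ⟩ : ∃ U ∈ 𝓝 (0 : ℂ), AnalyticOnNhd ℂ ψ U := hψan.exists_mem_nhds_analyticOnNhd
  have hgood : ∀ᶠ z in 𝓝 (0 : ℂ), z ∈ U ∧ ω (ψ z) = z ∧ ψ z ∈ ball (0 : ℂ) ρ ∧ ψ z ∈ ball (0 : ℂ) 1 := by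
    filter_upwards [hUn, hright, hψt.eventually (ball_mem_nhds (0:ℂ) hρ), hψt.eventually hb]
      with z h1 h2 h3 h4 using ⟨h1, h2, h3, h4⟩
  obtain ⟨r₀, hr₀pos, hr₀⟩ := Metric.eventually_nhds_iff_ball.mp hgood
  set r₁ : ℝ := min r₀ 1 with hr₁
  have hr₁pos : 0 < r₁ := lt_min hr₀pos one_pos
  have hr₁le : r₁ ≤ 1 := min_le_right _ _
  have hr₁sub : ball (0 : ℂ) r₁ ⊆ ball 0 r₀ := ball_subset_ball (min_le_left _ _)
  set y₀ : ℂ → ℂ := fun z ↦ H (ψ z) with hy₀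
  have hy₀d : DifferentiableOn ℂ y₀ (ball (0 : ℂ) r₁) := by
    intro z hz
    have hz' := hr₀ z (hr₁sub hz)
    have h1 : DifferentiableAt ℂ ψ z := (hUψ z hz'.1).differentiableAt
    have h2 : DifferentiableAt ℂ H (ψ z) := hHd.differentiableAt (isOpen_ball.mem_nhds hz'.2.2.1)
    exact (h2.comp z h1).differentiableWithinAt
  -- the polynomial `𝒬(z, w) = ∏_{m ∈ roots (Φ z)} (w − m)`
  set b : ℕ → ℂ → ℂ := fun n z ↦ (((roots (Φ z)).map fun m ↦ X - C m).prod).coeff n with hbdef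
  have hQ : ∀ z w, ∑ n ∈ Finset.range (d + 1), b n z * w ^ n = 0 ↔ w ∈ roots (Φ z) :=
    fun z w ↦ sum_coeff_prod_X_sub_C_mul_pow_eq_zero_iff (roots (Φ z)) (hcard _) w
  have hy₀root : ∀ z ∈ ball (0 : ℂ) r₁, ∑ n ∈ Finset.range (d + 1), b n z * y₀ z ^ n = 0 := by
    intro z hz
    have hz' := hr₀ z (hr₁sub hz)
    rw [hQ]
    have h := hH (ψ z) hz'.2.2.1 (by simpa using hz'.2.2.2)
    rwa [← hΦω _ hz'.2.2.2, hz'.2.1] at h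
  -- local holomorphic root systems on the disc: pull back along `Φ`
  have hlocD : ∀ z₀ ∈ ball (0 : ℂ) 1, ∃ ε > 0, ∃ (m : ℕ) (Y : Fin m → ℂ → ℂ),
      (∀ i, DifferentiableOn ℂ (Y i) (ball z₀ ε)) ∧
      (∀ i, ∀ z ∈ ball z₀ ε, z ∈ ball (0 : ℂ) 1 →
        ∑ n ∈ Finset.range (d + 1), b n z * Y i z ^ n = 0) ∧
      ∀ z ∈ ball z₀ ε, z ∈ ball (0 : ℂ) 1 → ∀ w : ℂ,
        ∑ n ∈ Finset.range (d + 1), b n z * w ^ n = 0 → ∃ i, w = Y i z := by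
    intro z₀ hz₀
    obtain ⟨ε, hε, m, Y, hYd, hYr, hYall⟩ := hloc (Φ z₀) (hΦU hz₀)
    -- `Φ` maps a small ball around `z₀` into `ball (Φ z₀) ε`
    have hΦc : ContinuousAt Φ z₀ := (hΦ.differentiableAt (isOpen_ball.mem_nhds hz₀)).continuousAt
    obtain ⟨δ, hδ, hδsub⟩ : ∃ δ > 0, ball z₀ δ ⊆ ball (0 : ℂ) 1 ∩ Φ ⁻¹' (ball (Φ z₀) ε) := by
      have h1 : ball (0 : ℂ) 1 ∩ Φ ⁻¹' (ball (Φ z₀) ε) ∈ 𝓝 z₀ :=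
        Filter.inter_mem (isOpen_ball.mem_nhds hz₀) (hΦc.preimage_mem_nhds (ball_mem_nhds _ hε))
      exact Metric.mem_nhds_iff.mp h1
    refine ⟨δ, hδ, m, fun i z ↦ Y i (Φ z), fun i ↦ ?_, fun i z hz hz1 ↦ ?_, fun z hz hz1 w hw ↦ ?_⟩
    · exact (hYd i).comp (hΦ.mono fun z hz ↦ (hδsub hz).1) fun z hz ↦ (hδsub hz).2
    · rw [hQ]; exact hYr i (Φ z) (hδsub hz).2 (hΦU hz1)
    · rw [hQ] at hw; exact hYall (Φ z) (hδsub hz).2 (hΦU hz1) w hw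
  -- continuation (tree: `RootContinuation.exists_holomorphic_root_extend`)
  obtain ⟨y, hyd, hyroot, hyy₀⟩ := RootContinuation.exists_holomorphic_root_extend (R := 1) hlocD
    hr₁pos hr₁le hy₀d hy₀root
  refine ⟨ω, y, hωd, hωm, hω0, hΦω, hyd, fun z hz ↦ (hQ z (y z)).mp (hyroot z hz), ?_⟩
  -- `y (ω t) = y₀ (ω t) = H (ψ (ω t)) = H t` near `0`
  have hωt : Tendsto ω (𝓝 0) (𝓝 0) := by
    simpa [ContinuousAt, hω0] using hωan.continuousAt
  filter_upwards [hleft, hωt.eventually (ball_mem_nhds (0 : ℂ) hr₁pos)] with t ht hωt'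
  rw [hyy₀ _ hωt', hy₀]
  simp only [ht]

end Literature.Analysis.Complex

end
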